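import Mathlib
import Summits.CriticalPhenomena.CardyFormulaZ2.Theorems.CardyMagicRigidityPositiveConeDefs
import Summits.CriticalPhenomena.CardyFormulaZ2.Theorems.CardyMagicRigidityNestingRigidityCloudAdmissibility
import Summits.CriticalPhenomena.CardyFormulaZ2.Theorems.CardyMagicRigidityNestingRigidityTowerCountMeasurable
import Summits.CriticalPhenomena.CardyFormulaZ2.Theorems.CardyMagicRigidityNestingRigidityTowerPressureSanity
import Literature.Probability.Percolation.NestingPhaseEstimates
import Literature.Probability.Percolation.SiteNestingWeightBound
import HarnessLib

/-!
# Crux `NestingRigidity`, line `ring-cloud-tomography` (r3): the cone cloud on the loop side, on BOTH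
# lattices (deterministic half of stub R1 `stub_coneTilt`)

Crux `Summit.CriticalPhenomena.CardyFormulaZ2.Theses.CardyMagicRigidity.NestingRigidity`
(stmt-CriticalPhenomena-4835), line `ring-cloud-tomography`, skeleton r3, stub R1
`stub_coneTilt : ∀ E ∈ latticeEnsembles, E.CloudLaw → ConeTiltLaw E`.  R1 feeds the cloud law with the
CONE CLOUD `𝔠(t, r)` (bump of charge `t` on `B(0, r)`, ring of charge `−t` on `{1 ≤ ‖z‖ < 2}`), i.e. the
`Cloud` literal `Cloud.mk 1 1 (fun _ ↦ 0) (fun _ ↦ r) (fun _ ↦ t) (fun _ ↦ 0) (fun _ ↦ 1) (fun _ ↦ 2)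
(fun _ ↦ -t)` — DEFINITIONALLY (`rfl`) the sibling line's `coneCloud t r` (`…ConeLever`: Gaussian side,
bond-`ℤ²` factorisation, `coneTiltLaw_of_cloudLaw : E.CloudLaw → UVDecoupling E → ConeTiltLaw E`); in
§2–§3 a cloud variable `𝔠` is pinned to it by a hypothesis `h𝔠` (instantiate with `rfl`, also at
`coneCloud t r`).  This file adds what R1 needs on BOTH lattice ensembles and on the loop side —
deterministic, proved, no cited facts, no definitions:

* §1 the BITE FORMULA for any cloud, `∫_{int u} f = Σ_i a_i φ_i(u) + Σ_k g_k ψ_k(u)`, the fractions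
  `φ_i, ψ_k ∈ [0, 1]` of each carrier's mass inside the winding interior `int u = {W(u,·) ≠ 0}` (set
  integrals over an ARBITRARY set; reusable for the staircase clouds of R2), and BITE COUNTING (Fubini)
  `Σ_{u ∈ S} ∫_{int u} g = ∫ g · #{u ∈ S : z ∈ int u}` — the bridge from UV drifts to nesting counts;
* §2 CONE POSITIVITY: every loop has phase `t(φ − ψ)`, `|phase| ≤ |t|`; for `|t| ≤ π/6` EVERY weight
  lies in `[w(|t|), w(−|t|)] ⊆ [0, 2]` (`w = magicWeight`) and `A_{𝔠(t,r)} ≥ 0` pathwise — the tilted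
  measure is an honest non-negative measure (precondition of every RSW / quasi-multiplicativity step);
* §3 tower loops (`B̄(0,r) ⊆ int u`, trace in `B(0,1)`) weigh exactly `w(t)`; a loop with trace in
  `B(0,1)` never bites the ring (`ψ = 0`, phase `tφ`) and weighs `1` if its interior misses the bump
  (loops missing `B̄(0, 2)` weigh `1`: `nestingFactor_eq_one_of_disjoint`);
* §4 the FACTORISATION ON BOTH LATTICES (registered: `nestingWeight_coneCloud_eq_latticeEnsembles`): an
  abstract tower factorisation `A_f(c) = w^{#T} ∏ᶠ_{u ∉ T} w_u` (any finite equal-weight family `T`;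
  reusable for R2), finiteness of the loops of `X_δ(ω)` meeting a ball on `ℤ²` AND `𝕋`
  (`ncard_loops_meeting_le`, `ncard_loops_siteLoopConfig_meeting_le`), hence
  `A_{𝔠(t,r)}(X_δ ω) = w(t)^{N_0(r,1)} ∏ᶠ_{u ∉ tower} w_u`; a deterministic bound `N_0 ≤ N(δ)`, so `u^{N_0}`
  is integrable for EVERY `u ≥ 0` (the cone needs `w(t) ∈ (1, √3)` for `t < 0`);
* §5 EXACT SUPER-ADDITIVITY `N_0(ρ₁, 1) + N_0(ρ₁ρ₂, ρ₁) ≤ N_0(ρ₁ρ₂, 1)` (disjoint sub-families), pathwise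
  on both lattices.

With `…ConeLever`, stub R1 is then EXACTLY the named loop-side estimates `UVDecoupling zEns`,
`UVDecoupling tEns` away (RSW separation of scales for the non-negative non-tower factors; not asserted).
-/

noncomputable section

open MeasureTheory Set Filter Metric
open scoped Real Topology BigOperators

namespace Summit.CriticalPhenomena.CardyFormulaZ2.Cruxes.NestingRigidity.RingCloudTomography

open Literature.Probability.RandomPlanarGeometry Literature.Probability.Percolation
  Literature.Probability.LatticeModels
open Summit.CriticalPhenomena.CardyFormulaZ2.Cruxes.NestingRigidity.PositiveConeWeightDoubling
  (magicWeight)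

namespace ConeTilt

/-! ## §1 Fractions of a carrier's mass inside a set; the bite formula; bite counting -/

/-- The disc density is non-negative. -/
theorem discDensity_nonneg (x : ℂ) (r : ℝ) (z : ℂ) : 0 ≤ discDensity x r z :=
  Set.indicator_nonneg (fun _ _ ↦ by positivity) z

/-- The ring density is non-negative (for `0 ≤ L ≤ M`). -/
theorem annulusDensity_nonneg (c : ℂ) {L M : ℝ} (hL : 0 ≤ L) (hLM : L ≤ M) (z : ℂ) :
    0 ≤ annulusDensity c L M z := by
  unfold annulusDensity
  refine Set.indicator_nonneg (fun _ _ ↦ ?_) z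
  have : 0 ≤ M ^ 2 - L ^ 2 := by nlinarith
  positivity

/-- The fraction of a disc's mass inside ANY set lies in `[0, 1]`. -/
theorem setIntegral_discDensity_mem_Icc (x : ℂ) {r : ℝ} (hr : 0 < r) (U : Set ℂ) :
    ∫ z in U, discDensity x r z ∈ Set.Icc (0 : ℝ) 1 := by
  refine ⟨integral_nonneg fun z ↦ discDensity_nonneg x r z, ?_⟩
  rw [← CloudAdmissibility.integral_discDensity x hr]
  exact setIntegral_le_integral (CloudAdmissibility.integrable_discDensity x r)
    (Eventually.of_forall fun z ↦ discDensity_nonneg x r z)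

/-- The fraction of a ring's mass inside ANY set lies in `[0, 1]`. -/
theorem setIntegral_annulusDensity_mem_Icc (c : ℂ) {L M : ℝ} (hL : 0 < L) (hLM : L < M) (U : Set ℂ) :
    ∫ z in U, annulusDensity c L M z ∈ Set.Icc (0 : ℝ) 1 := by
  refine ⟨integral_nonneg fun z ↦ annulusDensity_nonneg c hL.le hLM.le z, ?_⟩
  rw [← CloudAdmissibility.integral_annulusDensity c hL hLM]
  exact setIntegral_le_integral (CloudAdmissibility.integrable_annulusDensity c L M)
    (Eventually.of_forall fun z ↦ annulusDensity_nonneg c hL.le hLM.le z)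

/-- A disc inside the set has all its mass inside (fraction `1`) … -/
theorem setIntegral_discDensity_eq_one (x : ℂ) {r : ℝ} (hr : 0 < r) {U : Set ℂ}
    (hU : ball x r ⊆ U) : ∫ z in U, discDensity x r z = 1 := by
  rw [setIntegral_eq_integral_of_forall_compl_eq_zero fun z hz ↦ ?_,
    CloudAdmissibility.integral_discDensity x hr]
  exact Set.indicator_of_notMem (fun h ↦ hz (hU h)) _

/-- … a disc outside the set has none (fraction `0`) … -/
theorem setIntegral_discDensity_eq_zero (x : ℂ) (r : ℝ) {U : Set ℂ} (hU : Disjoint U (ball x r)) :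
    ∫ z in U, discDensity x r z = 0 :=
  setIntegral_eq_zero_of_forall_eq_zero fun _ hz ↦ Set.indicator_of_notMem (Set.disjoint_left.1 hU hz) _

/-- … and so has a ring outside the set. -/
theorem setIntegral_annulusDensity_eq_zero (c : ℂ) (L M : ℝ) {U : Set ℂ}
    (hU : Disjoint U {z : ℂ | L ≤ ‖z - c‖ ∧ ‖z - c‖ < M}) : ∫ z in U, annulusDensity c L M z = 0 :=
  setIntegral_eq_zero_of_forall_eq_zero fun _ hz ↦ Set.indicator_of_notMem (Set.disjoint_left.1 hU hz) _

/-- **Bite formula.** The phase `∫_{W(u,·) ≠ 0} f` of a loop against ANY cloud density is the sum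
over the carriers of (charge) × (fraction of the carrier's mass inside the winding interior). -/
theorem nestingPhase_density (𝔠 : Cloud) (u : UnbasedLoop ℂ) :
    u.nestingPhase 𝔠.density =
      (∑ i, 𝔠.a i * ∫ z in {z | u.wind z ≠ 0}, discDensity (𝔠.x i) (𝔠.r i) z) +
        ∑ k, 𝔠.g k * ∫ z in {z | u.wind z ≠ 0}, annulusDensity (𝔠.c k) (𝔠.L k) (𝔠.M k) z := by
  have h1 : ∀ i, Integrable (fun z ↦ 𝔠.a i * discDensity (𝔠.x i) (𝔠.r i) z)
      (volume.restrict {z | u.wind z ≠ 0}) := fun i ↦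
    ((CloudAdmissibility.integrable_discDensity _ _).const_mul _).restrict
  have h2 : ∀ k, Integrable (fun z ↦ 𝔠.g k * annulusDensity (𝔠.c k) (𝔠.L k) (𝔠.M k) z)
      (volume.restrict {z | u.wind z ≠ 0}) := fun k ↦
    ((CloudAdmissibility.integrable_annulusDensity _ _ _).const_mul _).restrict
  unfold UnbasedLoop.nestingPhase Cloud.density
  rw [integral_add (integrable_finsetSum _ fun i _ ↦ h1 i) (integrable_finsetSum _ fun k _ ↦ h2 k),
    integral_finsetSum _ fun i _ ↦ h1 i, integral_finsetSum _ fun k _ ↦ h2 k]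
  simp only [integral_const_mul]

/-- **Bite counting (Fubini).** For a finite family of loops and an integrable density `g`, the total
bite `Σ_{u ∈ S} ∫_{int u} g` is the `g`-average of the NESTING COUNT `z ↦ #{u ∈ S : z ∈ int u}`. -/
theorem sum_setIntegral_wind_eq (S : Finset (UnbasedLoop ℂ)) {g : ℂ → ℝ} (hg : Integrable g) :
    ∑ u ∈ S, ∫ z in {z | u.wind z ≠ 0}, g z =
      ∫ z, g z * ((S.filter fun u ↦ u.wind z ≠ 0).card : ℝ) := by
  classical
  have hm : ∀ u : UnbasedLoop ℂ, MeasurableSet {z | u.wind z ≠ 0} := measurableSet_setOf_wind_ne_zero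
  simp_rw [← integral_indicator (hm _)]
  rw [← integral_finsetSum _ fun u _ ↦ hg.indicator (hm u)]
  refine integral_congr_ae (Eventually.of_forall fun z ↦ ?_)
  simp only [Finset.card_filter, Nat.cast_sum, Finset.mul_sum]
  refine Finset.sum_congr rfl fun u _ ↦ ?_
  by_cases h : u.wind z ≠ 0
  · rw [Set.indicator_of_mem (by exact h), if_pos h, Nat.cast_one, mul_one]
  · rw [Set.indicator_of_notMem (by exact h), if_neg h, Nat.cast_zero, mul_zero]

/-- The winding interior of a loop inside an open ball lies in that ball. -/
theorem setOf_wind_ne_zero_subset_ball {u : UnbasedLoop ℂ} {x : ℂ} {R : ℝ} (hu : u.range ⊆ ball x R) :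
    {z | u.wind z ≠ 0} ⊆ ball x R := fun z hz ↦
  by_contra fun h ↦ hz (u.wind_eq_zero_of_subset_ball hu (by rwa [mem_ball, not_lt] at h))

/-- **Inner loops do not bite outer rings**: a loop with trace in the unit window has `ψ = 0` for
every ring of inner radius `≥ 1` centred at the origin. -/
theorem setIntegral_annulusDensity_eq_zero_of_range_subset {u : UnbasedLoop ℂ}
    (hu : u.range ⊆ ball (0 : ℂ) 1) {L : ℝ} (hL : 1 ≤ L) (M : ℝ) :
    ∫ z in {z | u.wind z ≠ 0}, annulusDensity 0 L M z = 0 := by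
  refine setIntegral_annulusDensity_eq_zero 0 L M (Set.disjoint_left.2 fun z hz hz' ↦ ?_)
  have h1 : ‖z‖ < 1 := by simpa using setOf_wind_ne_zero_subset_ball hu hz
  have h2 : L ≤ ‖z‖ := by simpa using hz'.1
  linarith

/-! ## §2 The cone cloud and cone positivity -/

section Cone

/-! In §2–§3, `𝔠` is THE CONE CLOUD: `h𝔠` pins it to the `Cloud` literal (bump `(0, r, t)` + ring
`(0, 1, 2, −t)`); instantiate with `rfl`, also at the sibling line's `coneCloud t r` (same literal). -/

variable {𝔠 : Cloud} {t r : ℝ}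
  (h𝔠 : 𝔠 = Cloud.mk 1 1 (fun _ ↦ 0) (fun _ ↦ r) (fun _ ↦ t) (fun _ ↦ 0) (fun _ ↦ 1) (fun _ ↦ 2) (fun _ ↦ -t))
include h𝔠

/-- For `0 < r ≤ 1` the cone cloud is admissible (the bump sits in the ring's hole). -/
theorem cone_admissible (hr : 0 < r) (hr1 : r ≤ 1) : 𝔠.Admissible := by
  subst h𝔠
  exact ⟨fun _ ↦ hr, fun _ ↦ one_pos, fun _ ↦ by norm_num, by simp,
    fun i j hij ↦ absurd (Subsingleton.elim i j) hij, fun _ _ ↦ Or.inl (by simpa using hr1),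
    fun k l hkl ↦ absurd (Subsingleton.elim k l) hkl⟩

/-- The cone density vanishes off `B̄(0, 2)` (`r ≤ 2`) … -/
theorem cone_density_eq_zero (hr2 : r ≤ 2) {z : ℂ} (hz : 2 < ‖z‖) : 𝔠.density z = 0 := by
  subst h𝔠
  simp only [Cloud.density, Fin.sum_univ_one]
  rw [CloudAdmissibility.discDensity_eq_zero (by rw [sub_zero]; linarith),
    CloudAdmissibility.annulusDensity_eq_zero (by rw [sub_zero]; linarith), mul_zero, mul_zero, add_zero]

/-- … and has mean zero (`0 < r ≤ 1`). -/
theorem integral_cone_density (hr : 0 < r) (hr1 : r ≤ 1) : ∫ z, 𝔠.density z = 0 :=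
  CloudAdmissibility.integral_density _ (cone_admissible h𝔠 hr hr1)

/-- **Bite formula for the cone cloud**: the phase of any loop is `t (φ − ψ)`, `φ` the fraction of the
bump's mass and `ψ` the fraction of the ring's mass inside the winding interior. -/
theorem cone_nestingPhase_eq (u : UnbasedLoop ℂ) :
    u.nestingPhase 𝔠.density =
      t * ((∫ z in {z | u.wind z ≠ 0}, discDensity 0 r z) -
        ∫ z in {z | u.wind z ≠ 0}, annulusDensity 0 1 2 z) := by
  subst h𝔠; rw [nestingPhase_density]; simp only [Fin.sum_univ_one]; ring

/-- **Cone bound on the phase**: `|θ_u| ≤ |t|` for EVERY loop `u` (both fractions lie in `[0, 1]`). -/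
theorem abs_cone_nestingPhase_le (hr : 0 < r) (u : UnbasedLoop ℂ) : |u.nestingPhase 𝔠.density| ≤ |t| := by
  rw [cone_nestingPhase_eq h𝔠, abs_mul]
  have h₁ := setIntegral_discDensity_mem_Icc 0 hr {z | u.wind z ≠ 0}
  have h₂ := setIntegral_annulusDensity_mem_Icc 0 one_pos one_lt_two {z | u.wind z ≠ 0}
  exact mul_le_of_le_one_right (abs_nonneg t) (abs_le.2 ⟨by linarith [h₁.1, h₂.2], by linarith [h₁.2, h₂.1]⟩)

/-- **Cone positivity, sharp form**: for `|t| ≤ π/6` every loop weight against the cone cloud lies in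
`[w(|t|), w(−|t|)] = [2cos(|t| + π/3), 2cos(π/3 − |t|)]`. -/
theorem cone_nestingFactor_mem_Icc (ht : |t| ≤ π / 6) (hr : 0 < r) (u : UnbasedLoop ℂ) :
    u.nestingFactor 𝔠.density ∈ Set.Icc (magicWeight |t|) (magicWeight (-|t|)) := by
  have hθ := abs_le.1 (abs_cone_nestingPhase_le h𝔠 hr u)
  set θ := u.nestingPhase 𝔠.density with hθdef
  rw [UnbasedLoop.nestingFactor, ← hθdef, magicWeight, magicWeight]
  have hπ := Real.pi_pos
  refine ⟨mul_le_mul_of_nonneg_left ?_ zero_le_two, mul_le_mul_of_nonneg_left ?_ zero_le_two⟩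
  · exact Real.cos_le_cos_of_nonneg_of_le_pi (by linarith [abs_nonneg t]) (by linarith) (by linarith)
  · exact Real.cos_le_cos_of_nonneg_of_le_pi (by linarith) (by linarith [abs_nonneg t]) (by linarith)

omit h𝔠 in
/-- In the closed cone the lower weight `w(|t|) = 2cos(|t| + π/3)` is non-negative. -/
theorem magicWeight_abs_nonneg (ht : |t| ≤ π / 6) : 0 ≤ magicWeight |t| :=
  mul_nonneg zero_le_two (Real.cos_nonneg_of_mem_Icc
    ⟨by linarith [abs_nonneg t, Real.pi_pos], by linarith [Real.pi_pos]⟩)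

/-- **Cone positivity**: for `|t| ≤ π/6` EVERY loop weight against the cone cloud is `≥ 0` (and `≤ 2`,
`UnbasedLoop.abs_nestingFactor_le`) … -/
theorem cone_nestingFactor_nonneg (ht : |t| ≤ π / 6) (hr : 0 < r) (u : UnbasedLoop ℂ) :
    0 ≤ u.nestingFactor 𝔠.density :=
  (magicWeight_abs_nonneg ht).trans (cone_nestingFactor_mem_Icc h𝔠 ht hr u).1

/-- … hence every partial product of weights (e.g. the NON-tower, UV / boundary, factor) is `≥ 0` … -/
theorem cone_finprod_mem_nonneg (ht : |t| ≤ π / 6) (hr : 0 < r) (S : Set (UnbasedLoop ℂ)) :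
    0 ≤ ∏ᶠ u ∈ S, u.nestingFactor 𝔠.density :=
  finprod_mem_induction (fun x ↦ 0 ≤ x) zero_le_one (fun _ _ ↦ mul_nonneg)
    fun u _ ↦ cone_nestingFactor_nonneg h𝔠 ht hr u

/-- … and so is the loop functional `A_𝔠(c) = ∏ᶠ_u w_u` of EVERY configuration. -/
theorem cone_nestingWeight_nonneg (ht : |t| ≤ π / 6) (hr : 0 < r) (c : LoopConfig ℂ) :
    0 ≤ c.nestingWeight 𝔠.density :=
  cone_finprod_mem_nonneg h𝔠 ht hr c.loops

/-! ## §3 Tower loops and inner loops -/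

/-- An inner loop (trace in the unit window) has phase `t φ` against the cone cloud, `φ ∈ [0, 1]` the
fraction of the bump inside it (it never bites the ring). -/
theorem cone_nestingPhase_of_range_subset {u : UnbasedLoop ℂ} (hu : u.range ⊆ ball (0 : ℂ) 1) :
    u.nestingPhase 𝔠.density = t * ∫ z in {z | u.wind z ≠ 0}, discDensity 0 r z := by
  rw [cone_nestingPhase_eq h𝔠, setIntegral_annulusDensity_eq_zero_of_range_subset hu le_rfl 2, sub_zero]

/-- **Tower loops carry the full charge**: `B̄(0, r)` inside the winding interior and trace in the unit
window give phase exactly `t`, hence weight `w(t) = magicWeight t`. -/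
theorem cone_nestingFactor_of_tower (hr : 0 < r) {u : UnbasedLoop ℂ}
    (hU : closedBall (0 : ℂ) r ⊆ {z | u.wind z ≠ 0}) (hu : u.range ⊆ ball (0 : ℂ) 1) :
    u.nestingFactor 𝔠.density = magicWeight t := by
  rw [UnbasedLoop.nestingFactor, cone_nestingPhase_of_range_subset h𝔠 hu,
    setIntegral_discDensity_eq_one 0 hr (ball_subset_closedBall.trans hU), mul_one]
  rfl

/-- Inner loops whose winding interior misses the bump weigh `1` (e.g. loops in `r ≤ ‖z‖ < 1`). -/
theorem cone_nestingFactor_of_disjoint_ball {u : UnbasedLoop ℂ} (hu : u.range ⊆ ball (0 : ℂ) 1)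
    (hU : Disjoint {z | u.wind z ≠ 0} (ball (0 : ℂ) r)) : u.nestingFactor 𝔠.density = 1 := by
  apply UnbasedLoop.nestingFactor_eq_one_of_nestingPhase_eq_zero
  rw [cone_nestingPhase_of_range_subset h𝔠 hu, setIntegral_discDensity_eq_zero 0 r hU, mul_zero]

end Cone

/-! ## §4 The factorisation on both lattice ensembles -/

/-- **Abstract tower factorisation.** If finitely many loops of `c` meet the closed ball carrying a
mean-zero density `f`, and every loop of a finite family `T ⊆ c.loops` has the same weight `w`, then
`A_f(c) = w^{#T} · ∏ᶠ_{u ∈ c.loops ∖ T} w_u` (honest finite products: the loops with weight `≠ 1` meet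
`B̄(0, R)`).  Reusable for the staircase clouds of R2 (band-0 tower). -/
theorem nestingWeight_eq_pow_mul_finprod {c : LoopConfig ℂ} {f : ℂ → ℝ} {R w : ℝ}
    {T : Set (UnbasedLoop ℂ)}
    (hfin : {u ∈ c.loops | (u.range ∩ closedBall (0 : ℂ) R).Nonempty}.Finite)
    (hR : ∀ z, R < ‖z‖ → f z = 0) (h0 : ∫ z, f z = 0) (hT : T ⊆ c.loops) (hTfin : T.Finite)
    (hw : ∀ u ∈ T, u.nestingFactor f = w) :
    c.nestingWeight f = w ^ T.ncard * ∏ᶠ u ∈ c.loops \ T, u.nestingFactor f := by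
  have hms : (c.loops ∩ Function.mulSupport fun u : UnbasedLoop ℂ ↦ u.nestingFactor f).Finite :=
    hfin.subset fun u hu ↦ ⟨hu.1, range_inter_closedBall_nonempty_of_nestingFactor_ne_one hR h0 hu.2⟩
  have key : ∏ᶠ u ∈ c.loops, u.nestingFactor f =
      (∏ᶠ u ∈ T, u.nestingFactor f) * ∏ᶠ u ∈ c.loops \ T, u.nestingFactor f := by
    rw [← finprod_mem_union' Set.disjoint_sdiff_right (hTfin.inter_of_left _)
      (hms.subset (Set.inter_subset_inter_left _ Set.sdiff_subset)), Set.union_sdiff_cancel hT]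
  rw [LoopConfig.nestingWeight, key, finprod_mem_congr rfl hw, finprod_mem_eq_finite_toFinset_prod _ hTfin,
    Finset.prod_const, Set.ncard_eq_toFinset_card T hTfin]

/-- **On both lattice ensembles finitely many loops meet any ball** (mesh `δ > 0`):
`ncard_loops_meeting_le` (bond-`ℤ²`, corners of a finite box) and
`ncard_loops_siteLoopConfig_meeting_le` (site-`𝕋`, faces of a finite box). -/
theorem finite_loops_meeting : ∀ E ∈ latticeEnsembles, ∀ {δ : ℝ}, 0 < δ → ∀ (ω : E.Ω) (R : ℝ),
    {u ∈ (E.X δ ω).loops | (u.range ∩ closedBall (0 : ℂ) R).Nonempty}.Finite := by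
  intro E hE δ hδ ω R
  simp only [latticeEnsembles, Set.mem_insert_iff, Set.mem_singleton_iff] at hE
  rcases hE with rfl | rfl
  · exact (ncard_loops_meeting_le hδ R ω).1
  · exact (ncard_loops_siteLoopConfig_meeting_le hδ R ω).1

/-- The loops of a window `B(x, R)` meet the closed ball `B̄(0, ‖x‖ + R)`. -/
theorem windowLoops_subset_meeting (c : LoopConfig ℂ) (x : ℂ) (ρ R : ℝ) :
    {u ∈ c.loops | closedBall x ρ ⊆ {z | u.wind z ≠ 0} ∧ u.range ⊆ ball x R} ⊆
      {u ∈ c.loops | (u.range ∩ closedBall (0 : ℂ) (‖x‖ + R)).Nonempty} := fun u hu ↦ ⟨hu.1, by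
  obtain ⟨z, hz⟩ := u.range_nonempty
  refine ⟨z, hz, mem_closedBall.2 ?_⟩
  have h := mem_ball.1 (hu.2.2 hz)
  rw [dist_zero_right]
  linarith [norm_le_norm_add_norm_sub' z x, dist_eq_norm z x]⟩

/-- The tower of `X_δ(ω)` (indeed every loop family inside a window) is finite on both lattices. -/
theorem finite_towerSet : ∀ E ∈ latticeEnsembles, ∀ {δ : ℝ}, 0 < δ → ∀ (ω : E.Ω) (x : ℂ) (ρ R : ℝ),
    {u ∈ (E.X δ ω).loops | closedBall x ρ ⊆ {z | u.wind z ≠ 0} ∧ u.range ⊆ ball x R}.Finite :=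
  fun E hE _ hδ ω x ρ R ↦
    (finite_loops_meeting E hE hδ ω (‖x‖ + R)).subset (windowLoops_subset_meeting _ x ρ R)

/-- **The tower count is bounded by a deterministic constant on both lattices**: at mesh `δ > 0`,
`N_x(ρ, R)(ω) ≤ N(δ)` for all `ω` (corners, resp. faces, of a finite box). -/
theorem exists_towerCount_le : ∀ E ∈ latticeEnsembles, ∀ {δ : ℝ}, 0 < δ → ∀ (x : ℂ) (ρ R : ℝ),
    ∃ N : ℕ, ∀ ω : E.Ω, towerCount (E.X δ ω) x ρ R ≤ N := by
  intro E hE δ hδ x ρ R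
  simp only [latticeEnsembles, Set.mem_insert_iff, Set.mem_singleton_iff] at hE
  rcases hE with rfl | rfl
  · exact ⟨_, fun ω ↦ (Set.ncard_le_ncard (windowLoops_subset_meeting _ x ρ R)
      (ncard_loops_meeting_le hδ _ ω).1).trans (ncard_loops_meeting_le hδ (‖x‖ + R) ω).2⟩
  · exact ⟨_, fun ω ↦ (Set.ncard_le_ncard (windowLoops_subset_meeting _ x ρ R)
      (ncard_loops_siteLoopConfig_meeting_le hδ _ ω).1).trans
        (ncard_loops_siteLoopConfig_meeting_le hδ (‖x‖ + R) ω).2⟩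

/-- **Integrability of `u^{N_x(ρ,R)}` for EVERY weight `u ≥ 0` on both lattices** (measurable by
`measurable_towerCount`, bounded by `max 1 u ^ N(δ)`, probability law) — the cone needs the weights
`w(t) ∈ (1, √3)` for `t < 0`, beyond `integrable_pow_towerCount` (`u ≤ 1`). -/
theorem integrable_pow_towerCount_of_nonneg : ∀ E ∈ latticeEnsembles, ∀ (u : ℝ) {δ : ℝ}, 0 < δ →
    ∀ (x : ℂ) (ρ R : ℝ), 0 ≤ u → Integrable (fun ω ↦ u ^ towerCount (E.X δ ω) x ρ R) E.P := by
  intro E hE u δ hδ x ρ R hu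
  haveI := isProbabilityMeasure_of_mem hE
  obtain ⟨N, hN⟩ := exists_towerCount_le E hE hδ x ρ R
  refine Integrable.of_bound ((measurable_towerCount E hE δ x ρ R).const_pow u).aestronglyMeasurable
    (max 1 u ^ N) (Eventually.of_forall fun ω ↦ ?_)
  rw [Real.norm_eq_abs, abs_of_nonneg (pow_nonneg hu _)]
  exact (pow_le_pow_left₀ hu (le_max_right 1 u) _).trans
    (pow_le_pow_right₀ (le_max_left 1 u) (hN ω))

end ConeTilt

/-- **Factorisation of the cone functional on BOTH lattice ensembles** (registered helper toward stub
R1 `stub_coneTilt`, line `ring-cloud-tomography` r3): for `E ∈ latticeEnsembles`, mesh `δ > 0`, sample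
`ω`, charge `t`, radius `0 < r ≤ 1`, the loop functional of the cone cloud (the `Cloud` literal is
definitionally `coneCloud t r`) is EXACTLY `w(t)^{N_0(r,1)} · ∏ᶠ_{u ∉ tower} w_u` (`w = magicWeight`,
`N_0(r,1) = towerCount (E.X δ ω) 0 r 1`; the other factors lie in `[w(|t|), w(−|t|)] ⊆ [0, 2]` for
`|t| ≤ π/6`, `ConeTilt.cone_nestingFactor_mem_Icc`). -/
theorem nestingWeight_coneCloud_eq_latticeEnsembles : ∀ E ∈ latticeEnsembles, ∀ {δ : ℝ}, 0 < δ →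
    ∀ (ω : E.Ω) (t : ℝ) {r : ℝ}, 0 < r → r ≤ 1 →
    (E.X δ ω).nestingWeight (Cloud.mk 1 1 (fun _ ↦ 0) (fun _ ↦ r) (fun _ ↦ t) (fun _ ↦ 0) (fun _ ↦ 1)
      (fun _ ↦ 2) (fun _ ↦ -t)).density =
      magicWeight t ^ towerCount (E.X δ ω) 0 r 1 *
        ∏ᶠ u ∈ (E.X δ ω).loops \ {u ∈ (E.X δ ω).loops | Metric.closedBall (0 : ℂ) r ⊆ {z | u.wind z ≠ 0} ∧
          u.range ⊆ Metric.ball (0 : ℂ) 1},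
          u.nestingFactor (Cloud.mk 1 1 (fun _ ↦ 0) (fun _ ↦ r) (fun _ ↦ t) (fun _ ↦ 0) (fun _ ↦ 1)
            (fun _ ↦ 2) (fun _ ↦ -t)).density :=
  fun E hE _ hδ ω _ r hr hr1 ↦
    ConeTilt.nestingWeight_eq_pow_mul_finprod (ConeTilt.finite_loops_meeting E hE hδ ω 2)
      (fun _ hz ↦ ConeTilt.cone_density_eq_zero rfl (by linarith) hz) (ConeTilt.integral_cone_density rfl hr hr1)
      (Set.sep_subset _ _) (ConeTilt.finite_towerSet E hE hδ ω 0 r 1)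
      fun _ hu ↦ ConeTilt.cone_nestingFactor_of_tower rfl hr hu.2.1 hu.2.2

namespace ConeTilt

/-! ## §5 Exact super-additivity of the tower counts -/

/-- **Exact super-additivity of tower counts** (deterministic): for `0 ≤ ρ₁ ≤ 1`, `ρ₂ ≤ 1`, the towers
`(ρ₁; B(0,1))` and `(ρ₁ρ₂; B(0,ρ₁))` are DISJOINT sub-families of the tower `(ρ₁ρ₂; B(0,1))` (a loop
inside `B(0, ρ₁)` does not wind around the point `ρ₁ ∈ B̄(0, ρ₁)`), whence
`N_0(ρ₁, 1) + N_0(ρ₁ρ₂, ρ₁) ≤ N_0(ρ₁ρ₂, 1)` as soon as the big tower is finite. -/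
theorem towerCount_add_le {c : LoopConfig ℂ} {ρ₁ ρ₂ : ℝ} (h₀ : 0 ≤ ρ₁) (h₁ : ρ₁ ≤ 1) (h₂ : ρ₂ ≤ 1)
    (hfin : {u ∈ c.loops | closedBall (0 : ℂ) (ρ₁ * ρ₂) ⊆ {z | u.wind z ≠ 0} ∧
      u.range ⊆ ball (0 : ℂ) 1}.Finite) :
    towerCount c 0 ρ₁ 1 + towerCount c 0 (ρ₁ * ρ₂) ρ₁ ≤ towerCount c 0 (ρ₁ * ρ₂) 1 := by
  unfold towerCount
  set T₁ := {u ∈ c.loops | closedBall (0 : ℂ) ρ₁ ⊆ {z | u.wind z ≠ 0} ∧ u.range ⊆ ball (0 : ℂ) 1}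
  set T₂ := {u ∈ c.loops | closedBall (0 : ℂ) (ρ₁ * ρ₂) ⊆ {z | u.wind z ≠ 0} ∧ u.range ⊆ ball (0 : ℂ) ρ₁}
  set T₃ := {u ∈ c.loops | closedBall (0 : ℂ) (ρ₁ * ρ₂) ⊆ {z | u.wind z ≠ 0} ∧ u.range ⊆ ball (0 : ℂ) 1}
  have hsub₁ : T₁ ⊆ T₃ := fun u hu ↦
    ⟨hu.1, (closedBall_subset_closedBall (mul_le_of_le_one_right h₀ h₂)).trans hu.2.1, hu.2.2⟩
  have hsub₂ : T₂ ⊆ T₃ := fun u hu ↦ ⟨hu.1, hu.2.1, hu.2.2.trans (ball_subset_ball h₁)⟩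
  have hdisj : Disjoint T₁ T₂ := by
    refine Set.disjoint_left.2 fun u hu hu' ↦ ?_
    have hz : ((ρ₁ : ℝ) : ℂ) ∈ closedBall (0 : ℂ) ρ₁ := by simp [mem_closedBall, abs_of_nonneg h₀]
    exact hu.2.1 hz (u.wind_eq_zero_of_subset_ball hu'.2.2 (by simp [abs_of_nonneg h₀]))
  rw [← Set.ncard_union_eq hdisj (hfin.subset hsub₁) (hfin.subset hsub₂)]
  exact Set.ncard_le_ncard (Set.union_subset hsub₁ hsub₂) hfin

/-- **Exact super-additivity of tower counts on both lattice ensembles** (every mesh `δ > 0`, every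
sample): `N_0(ρ₁, 1) + N_0(ρ₁ρ₂, ρ₁) ≤ N_0(ρ₁ρ₂, 1)` for `0 ≤ ρ₁ ≤ 1`, `ρ₂ ≤ 1`. -/
theorem towerCount_add_le_latticeEnsembles : ∀ E ∈ latticeEnsembles, ∀ {δ : ℝ}, 0 < δ → ∀ (ω : E.Ω)
    {ρ₁ ρ₂ : ℝ}, 0 ≤ ρ₁ → ρ₁ ≤ 1 → ρ₂ ≤ 1 →
    towerCount (E.X δ ω) 0 ρ₁ 1 + towerCount (E.X δ ω) 0 (ρ₁ * ρ₂) ρ₁ ≤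
      towerCount (E.X δ ω) 0 (ρ₁ * ρ₂) 1 :=
  fun E hE _ hδ ω ρ₁ ρ₂ h₀ h₁ h₂ ↦
    towerCount_add_le h₀ h₁ h₂ (finite_towerSet E hE hδ ω 0 (ρ₁ * ρ₂) 1)

end ConeTilt

end Summit.CriticalPhenomena.CardyFormulaZ2.Cruxes.NestingRigidity.RingCloudTomography

end
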